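import Mathlib.Combinatorics.SimpleGraph.Maps
import Mathlib.Combinatorics.SimpleGraph.Connectivity.Connected
import Mathlib.Combinatorics.Enumerative.DoubleCounting
import Mathlib.Data.Fintype.Card
import Mathlib.Data.Finset.Card
import Mathlib.Tactic.Ring
import Literature.Combinatorics.SimpleGraph.ForcedHalves
import HarnessLib

/-!
# Sections of a connected half-bounded graph halve every cell (Laubner 2011, Lemma 3.3.7)

Fourth step of the Corneil–Goldberg section machinery [CorneilGoldberg1984] after
[Laubner2011, §3.3.2], undirected case, again for an arbitrary graph `K` with an EQUITABLE
colouring `ρ` satisfying the HALF BOUND `2 n_u(d) ≤ |P_d|` (the switching-equivalent graph,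
`ForcedHalves.lean`). Traces are the finsets `trace ρ H c = H ∩ P_c`.

* Connectivity tools: a set closed under adjacency in a preconnected graph is everything
  (`eq_univ_of_adjClosed`); hence (**Lemma 3.3.6**, global form) if no block is an exact half,
  a preconnected `K` has no non-trivial section (`not_hasSection_of_forall_ne`).
* Exact-half blocks (`2 n_{xy} = |P_y|`): empty traces propagate (`trace_empty_of_halfBlock`),
  a mixed trace on `P_x` forces an exact half trace on `P_y` (`two_mul_card_trace_of_halfBlock`),
  and a half trace on `P_y` is the `P_y`-neighbourhood of any `u ∈ P_x` or its complement
  (`trace_eq_or_eq_of_halfBlock`).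
* Forced blocks (`0 < n_{xy}`, `2 n_{xy} < |P_y|`): traces are proportional
  (`card_trace_mul_of_forced`) and are transported along equal-or-complementary traces
  (`trace_transport_of_forced`).
* **Lemma 3.3.7**: in a preconnected `K` with an exact-half block, every non-trivial section
  halves every colour class (`IsSection.two_mul_card_trace`), and two non-trivial sections have,
  on every class, equal or complementary traces (`IsSection.trace_eq_or_compl`).

## References

* B. Laubner, PhD thesis, HU Berlin 2011, doi:10.18452/16335, Lemmas 3.3.6–3.3.7; read
  pp. 46–47. [Laubner2011]
* D. G. Corneil, M. K. Goldberg, J. Algorithms 5 (1984) 345–362. [CorneilGoldberg1984]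
-/

namespace Literature.Combinatorics.SimpleGraph

open _root_.SimpleGraph Finset

universe u

variable {V : Type u} [Fintype V] [DecidableEq V]
variable {K : _root_.SimpleGraph V} [DecidableRel K.Adj] {κ : Type*} [DecidableEq κ] {ρ : V → κ}

/-! ## Traces and connectivity -/

/-- The trace `H ∩ P_c` of a set on a colour class, as a finset. [folklore] -/
def trace (ρ : V → κ) (H : Set V) [DecidablePred (· ∈ H)] (c : κ) : Finset V :=
  univ.filter fun w => ρ w = c ∧ w ∈ H

omit [DecidableEq V] in
/-- Membership in a trace. [folklore] -/
@[simp] theorem mem_trace {H : Set V} [DecidablePred (· ∈ H)] {c : κ} {w : V} :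
    w ∈ trace ρ H c ↔ ρ w = c ∧ w ∈ H := by
  simp [trace]

/-- Trace plus co-trace is the class. [folklore] -/
theorem card_trace_add_card_trace_compl (H : Set V) [DecidablePred (· ∈ H)] [DecidablePred (· ∈ Hᶜ)] (c : κ) :
    (trace ρ H c).card + (trace ρ Hᶜ c).card = cellCard ρ c := by
  rw [cellCard, ← card_union_of_disjoint]
  · congr 1
    ext w
    simp only [mem_union, mem_trace, Set.mem_compl_iff, mem_filter, mem_univ, true_and]
    tauto
  · rw [Finset.disjoint_left]
    intro w hw hw'
    rw [mem_trace] at hw hw'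
    exact hw'.2 hw.2

omit [Fintype V] [DecidableEq V] [DecidableRel K.Adj] in
/-- Along a walk, a set closed under adjacency is not left. [folklore] -/
theorem Walk.mem_of_adjClosed {C : Set V} (hC : ∀ ⦃u v : V⦄, u ∈ C → K.Adj u v → v ∈ C) :
    ∀ {u v : V}, K.Walk u v → u ∈ C → v ∈ C
  | _, _, SimpleGraph.Walk.nil, hu => hu
  | _, _, SimpleGraph.Walk.cons hadj p, hu => Walk.mem_of_adjClosed hC p (hC hu hadj)

omit [Fintype V] [DecidableEq V] [DecidableRel K.Adj] in
/-- In a preconnected graph a non-empty set closed under adjacency is everything. [folklore] -/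
theorem eq_univ_of_adjClosed (hK : K.Preconnected) {C : Set V}
    (hC : ∀ ⦃u v : V⦄, u ∈ C → K.Adj u v → v ∈ C) {u : V} (hu : u ∈ C) : C = Set.univ :=
  Set.eq_univ_of_forall fun v => (hK u v).elim fun p => Walk.mem_of_adjClosed hC p hu

/-- **Lemma 3.3.6, global form**: an equitable, half-bounded, PRECONNECTED graph in which no
block is an exact half has no non-trivial section. [cite: Laubner2011, Lemma 3.3.6 and Prop. 3.3.8] -/
theorem not_hasSection_of_forall_ne (hK : K.Preconnected) (hρ : IsEquitable K ρ)
    (hhalf : ∀ (u : V) (d : κ), 2 * adjCount K ρ u d ≤ cellCard ρ d)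
    (hne : ∀ (u : V) (d : κ), 2 * adjCount K ρ u d ≠ cellCard ρ d) : ¬ HasSection K ρ := by
  classical
  rintro ⟨H, ⟨u, hu⟩, ⟨v, hv⟩, hH⟩
  have := eq_univ_of_adjClosed hK (fun a b ha hab => hH.mem_of_mem_adj hρ hhalf hne ha hab) hu
  rw [this] at hv
  exact hv (Set.mem_univ v)

/-! ## Equation (N) consequences -/

omit [DecidableEq V] in
/-- For an exact-half block `(x, y)` the transposed block is an exact half too, and `|P_x|` is
even and positive: `2 n_v(x) = |P_x|` for `v ∈ P_y`. [cite: Laubner2011, proof of Lemma 3.3.7] -/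
theorem two_mul_adjCount_of_halfBlock (hρ : IsEquitable K ρ) {u₀ v : V}
    (hblk : 2 * adjCount K ρ u₀ (ρ v) = cellCard ρ (ρ v)) :
    2 * adjCount K ρ v (ρ u₀) = cellCard ρ (ρ u₀) := by
  have h := hρ.cellCard_mul_adjCount u₀ v
  have hY : 0 < cellCard ρ (ρ v) := card_pos.2 ⟨v, by simp⟩
  -- `|P_x| · n_{xy} = |P_y| · n_{yx}` and `2 n_{xy} = |P_y|`
  have : cellCard ρ (ρ v) * (2 * adjCount K ρ v (ρ u₀)) = cellCard ρ (ρ v) * cellCard ρ (ρ u₀) := by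
    calc cellCard ρ (ρ v) * (2 * adjCount K ρ v (ρ u₀))
        = 2 * (cellCard ρ (ρ v) * adjCount K ρ v (ρ u₀)) := by ring
      _ = 2 * (cellCard ρ (ρ u₀) * adjCount K ρ u₀ (ρ v)) := by rw [h]
      _ = cellCard ρ (ρ u₀) * (2 * adjCount K ρ u₀ (ρ v)) := by ring
      _ = cellCard ρ (ρ v) * cellCard ρ (ρ u₀) := by rw [hblk, Nat.mul_comm]
  exact Nat.eq_of_mul_eq_mul_left hY this

/-! ## Exact-half blocks -/

section HalfBlock

variable {H : Set V} [DecidablePred (· ∈ H)]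

omit [DecidableEq V] [DecidablePred (· ∈ H)] in
/-- **Empty traces propagate across an exact-half block.** [cite: Laubner2011, proof of Lemma 3.3.7] -/
theorem trace_empty_of_halfBlock (hρ : IsEquitable K ρ)
    (hhalf : ∀ (u : V) (d : κ), 2 * adjCount K ρ u d ≤ cellCard ρ d) (hH : IsSection K ρ H)
    {u₀ : V} {y : κ} (hblk : 2 * adjCount K ρ u₀ y = cellCard ρ y)
    (hx : ∀ u, ρ u = ρ u₀ → u ∉ H) {v : V} (hv : ρ v = y) : v ∉ H := by
  intro hvH
  subst hv
  -- the block `P_x × (P_y ∩ H)` is homogeneous, with the value `K.Adj u₀ v`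
  have hom : ∀ u : V, ρ u = ρ u₀ → (K.Adj u v ↔ K.Adj u₀ v) := fun u hu =>
    hH hu rfl (iff_of_false (hx u hu) (hx u₀ rfl)) Iff.rfl (fun h => hx u hu (h.2 hvH))
  have hvx := two_mul_adjCount_of_halfBlock hρ hblk
  have hX : 0 < cellCard ρ (ρ u₀) := card_pos.2 ⟨u₀, by simp⟩
  by_cases hadj : K.Adj u₀ v
  · -- then `v` sees all of `P_x`: contradicts the half bound
    have : cellCard ρ (ρ u₀) ≤ adjCount K ρ v (ρ u₀) := card_le_card fun u hu => by
      simp only [mem_filter, mem_univ, true_and] at hu ⊢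
      exact ⟨((hom u hu).2 hadj).symm, hu⟩
    have := hhalf v (ρ u₀)
    omega
  · -- then `v` sees nothing of `P_x`: contradicts `2 n_v(x) = |P_x| > 0`
    have : adjCount K ρ v (ρ u₀) = 0 := card_eq_zero.2 (eq_empty_of_forall_notMem fun u hu => by
      simp only [mem_filter, mem_univ, true_and] at hu
      exact hadj ((hom u hu.2).1 hu.1.symm))
    omega

omit [DecidableEq V] [DecidablePred (· ∈ H)] in
/-- Hence full traces propagate too. [cite: Laubner2011, proof of Lemma 3.3.7] -/
theorem trace_full_of_halfBlock (hρ : IsEquitable K ρ)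
    (hhalf : ∀ (u : V) (d : κ), 2 * adjCount K ρ u d ≤ cellCard ρ d) (hH : IsSection K ρ H)
    {u₀ : V} {y : κ} (hblk : 2 * adjCount K ρ u₀ y = cellCard ρ y)
    (hx : ∀ u, ρ u = ρ u₀ → u ∈ H) {v : V} (hv : ρ v = y) : v ∈ H := by
  by_contra hvH
  exact trace_empty_of_halfBlock hρ hhalf hH.compl hblk (fun u hu h => h (hx u hu)) hv hvH

/-- **A mixed trace on `P_x` forces an exact half trace on `P_y`** across an exact-half block.
[cite: Laubner2011, proof of Lemma 3.3.7] -/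
theorem two_mul_card_trace_of_halfBlock (hρ : IsEquitable K ρ) (hH : IsSection K ρ H)
    {u₀ : V} {y : κ} (hblk : 2 * adjCount K ρ u₀ y = cellCard ρ y)
    {u₁ u₂ : V} (hu₁ : ρ u₁ = ρ u₀) (hu₁H : u₁ ∈ H) (hu₂ : ρ u₂ = ρ u₀) (hu₂H : u₂ ∉ H) :
    2 * (trace ρ H y).card = cellCard ρ y := by
  haveI : DecidablePred (· ∈ Hᶜ) := fun x => show Decidable (x ∉ H) from inferInstance
  have hsum := card_trace_add_card_trace_compl (ρ := ρ) H y
  have hn : ∀ {u : V}, ρ u = ρ u₀ → 2 * adjCount K ρ u y = cellCard ρ y := fun hu => by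
    rw [hρ.adjCount_eq hu]; exact hblk
  -- `|P_y \ H| ≤ n`: the block `(H ∩ P_x) × (P_y \ H)` is full or empty
  have h₁ : 2 * (trace ρ Hᶜ y).card ≤ cellCard ρ y := by
    by_cases hex : ∃ v, ρ v = y ∧ v ∉ H ∧ K.Adj u₁ v
    · -- full: `P_y \ H ⊆ N(u₁)`
      obtain ⟨v, hv, hvH, hadj⟩ := hex
      have : (trace ρ Hᶜ y).card ≤ adjCount K ρ u₁ y := card_le_card fun w hw => by
        simp only [mem_trace, Set.mem_compl_iff, mem_filter, mem_univ, true_and] at hw ⊢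
        exact ⟨(hH (rfl : ρ u₁ = ρ u₁) (hv.trans hw.1.symm) (iff_of_true hu₁H hu₁H)
          (iff_of_false hvH hw.2) (fun h => hvH (h.1 hu₁H))).1 hadj, hw.1⟩
      have := hn hu₁
      omega
    · -- empty: `N(u₁) ∩ P_y ⊆ H`
      have : adjCount K ρ u₁ y ≤ (trace ρ H y).card := card_le_card fun w hw => by
        simp only [mem_trace, mem_filter, mem_univ, true_and] at hw ⊢
        exact ⟨hw.2, by_contra fun h => hex ⟨w, hw.2, h, hw.1⟩⟩
      have := hn hu₁
      omega
  -- `|P_y ∩ H| ≤ n`: the block `(P_x \ H) × (P_y ∩ H)` is full or empty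
  have h₂ : 2 * (trace ρ H y).card ≤ cellCard ρ y := by
    by_cases hex : ∃ v, ρ v = y ∧ v ∈ H ∧ K.Adj u₂ v
    · obtain ⟨v, hv, hvH, hadj⟩ := hex
      have : (trace ρ H y).card ≤ adjCount K ρ u₂ y := card_le_card fun w hw => by
        simp only [mem_trace, mem_filter, mem_univ, true_and] at hw ⊢
        exact ⟨(hH rfl (hv.trans hw.1.symm) Iff.rfl (iff_of_true hvH hw.2) (fun h => hu₂H (h.2 hvH))).1 hadj,
          hw.1⟩
      have := hn hu₂
      omega
    · have : adjCount K ρ u₂ y ≤ (trace ρ Hᶜ y).card := card_le_card fun w hw => by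
        simp only [mem_trace, Set.mem_compl_iff, mem_filter, mem_univ, true_and] at hw ⊢
        exact ⟨hw.2, fun h => hex ⟨w, hw.2, h, hw.1⟩⟩
      have := hn hu₂
      omega
  omega

/-- **A half trace on `P_y` is the `P_y`-neighbourhood of any `u ∈ P_x`, or its complement**
(across an exact-half block). [cite: Laubner2011, proof of Lemma 3.3.7] -/
theorem trace_eq_or_eq_of_halfBlock (hρ : IsEquitable K ρ) (hH : IsSection K ρ H)
    {u₀ : V} {y : κ} (hblk : 2 * adjCount K ρ u₀ y = cellCard ρ y)
    (hHy : 2 * (trace ρ H y).card = cellCard ρ y) {u : V} (hu : ρ u = ρ u₀) :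
    trace ρ H y = univ.filter (fun w => K.Adj u w ∧ ρ w = y) ∨
      trace ρ H y = (univ.filter fun w => ρ w = y) \ univ.filter (fun w => K.Adj u w ∧ ρ w = y) := by
  haveI : DecidablePred (· ∈ Hᶜ) := fun x => show Decidable (x ∉ H) from inferInstance
  have hsum := card_trace_add_card_trace_compl (ρ := ρ) H y
  have hn : 2 * adjCount K ρ u y = cellCard ρ y := by rw [hρ.adjCount_eq hu]; exact hblk
  have hNsub : univ.filter (fun w => K.Adj u w ∧ ρ w = y) ⊆ univ.filter fun w => ρ w = y :=
    fun w hw => by simp only [mem_filter, mem_univ, true_and] at hw ⊢; exact hw.2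
  -- the complement of the trace inside `P_y` is the co-trace
  have hcompl : (univ.filter fun w => ρ w = y) \ trace ρ H y = trace ρ Hᶜ y := by
    ext w
    simp only [mem_sdiff, mem_filter, mem_univ, true_and, mem_trace, Set.mem_compl_iff]
    tauto
  have htr_sub : trace ρ H y ⊆ univ.filter fun w => ρ w = y := fun w hw => by
    simp only [mem_trace, mem_filter, mem_univ, true_and] at hw ⊢; exact hw.1
  by_cases huH : u ∈ H
  · by_cases hex : ∃ v, ρ v = y ∧ v ∉ H ∧ K.Adj u v
    · -- full block `(H ∩ P_x) × (P_y \ H)`: the co-trace is `N(u) ∩ P_y`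
      right
      obtain ⟨v, hv, hvH, hadj⟩ := hex
      have hsub : trace ρ Hᶜ y ⊆ univ.filter (fun w => K.Adj u w ∧ ρ w = y) := fun w hw => by
        simp only [mem_trace, Set.mem_compl_iff, mem_filter, mem_univ, true_and] at hw ⊢
        exact ⟨(hH rfl (hv.trans hw.1.symm) Iff.rfl (iff_of_false hvH hw.2) (fun h => hvH (h.1 huH))).1 hadj, hw.1⟩
      have heq : trace ρ Hᶜ y = univ.filter (fun w => K.Adj u w ∧ ρ w = y) :=
        eq_of_subset_of_card_le hsub (by unfold adjCount at hn; omega)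
      rw [← heq, ← hcompl, sdiff_sdiff_right_self, inf_eq_inter, inter_eq_right.2 htr_sub]
    · -- empty block: `N(u) ∩ P_y ⊆ H`
      left
      have hsub : univ.filter (fun w => K.Adj u w ∧ ρ w = y) ⊆ trace ρ H y := fun w hw => by
        simp only [mem_trace, mem_filter, mem_univ, true_and] at hw ⊢
        exact ⟨hw.2, by_contra fun h => hex ⟨w, hw.2, h, hw.1⟩⟩
      exact (eq_of_subset_of_card_le hsub (by unfold adjCount at hn; omega)).symm
  · by_cases hex : ∃ v, ρ v = y ∧ v ∈ H ∧ K.Adj u v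
    · -- full block `(P_x \ H) × (P_y ∩ H)`: the trace is `N(u) ∩ P_y`
      left
      obtain ⟨v, hv, hvH, hadj⟩ := hex
      have hsub : trace ρ H y ⊆ univ.filter (fun w => K.Adj u w ∧ ρ w = y) := fun w hw => by
        simp only [mem_trace, mem_filter, mem_univ, true_and] at hw ⊢
        exact ⟨(hH rfl (hv.trans hw.1.symm) Iff.rfl (iff_of_true hvH hw.2) (fun h => huH (h.2 hvH))).1 hadj, hw.1⟩
      exact eq_of_subset_of_card_le hsub (by unfold adjCount at hn; omega)
    · -- empty block: `N(u) ∩ P_y ⊆ P_y \ H`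
      right
      have hsub : univ.filter (fun w => K.Adj u w ∧ ρ w = y) ⊆ trace ρ Hᶜ y := fun w hw => by
        simp only [mem_trace, Set.mem_compl_iff, mem_filter, mem_univ, true_and] at hw ⊢
        exact ⟨hw.2, fun h => hex ⟨w, hw.2, h, hw.1⟩⟩
      have heq : univ.filter (fun w => K.Adj u w ∧ ρ w = y) = trace ρ Hᶜ y :=
        eq_of_subset_of_card_le hsub (by unfold adjCount at hn; omega)
      rw [heq, ← hcompl, sdiff_sdiff_right_self, inf_eq_inter, inter_eq_right.2 htr_sub]

end HalfBlock

/-! ## Forced blocks -/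

section Forced

variable {H : Set V} [DecidablePred (· ∈ H)]

/-- **Across a forced block, traces are proportional**: `|H ∩ P_y| · |P_x| = |H ∩ P_x| · |P_y|`
(every edge between the classes runs inside `H` or inside its complement). [cite: Laubner2011, proof of Lemma 3.3.7] -/
theorem card_trace_mul_of_forced (hρ : IsEquitable K ρ)
    (hhalf : ∀ (u : V) (d : κ), 2 * adjCount K ρ u d ≤ cellCard ρ d) (hH : IsSection K ρ H)
    {u₀ : V} {y : κ} (h0 : 0 < adjCount K ρ u₀ y) (h2 : 2 * adjCount K ρ u₀ y < cellCard ρ y) :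
    (trace ρ H y).card * cellCard ρ (ρ u₀) = (trace ρ H (ρ u₀)).card * cellCard ρ y := by
  haveI : DecidablePred (· ∈ Hᶜ) := fun x => show Decidable (x ∉ H) from inferInstance
  -- if `P_y` is empty there is nothing to prove (`n = 0`); so pick `v₀ ∈ P_y`
  obtain ⟨v₀, hv₀⟩ : ∃ v₀, ρ v₀ = y := by
    obtain ⟨w, hw⟩ := card_pos.1 h0
    exact ⟨w, (mem_filter.1 hw).2.2⟩
  subst hv₀
  -- edges between `H ∩ P_x` and `H ∩ P_y`, counted from both sides
  have hdc := sum_card_bipartiteAbove_eq_sum_card_bipartiteBelow (s := trace ρ H (ρ u₀)) (t := trace ρ H (ρ v₀))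
    (r := fun a b => K.Adj a b)
  -- from the `x` side: every `P_y`-neighbour of `u ∈ H ∩ P_x` lies in `H`
  have hx : ∀ u ∈ trace ρ H (ρ u₀), ((trace ρ H (ρ v₀)).bipartiteAbove (fun a b => K.Adj a b) u).card =
      adjCount K ρ u₀ (ρ v₀) := by
    intro u hu
    rw [mem_trace] at hu
    rw [← hρ.adjCount_eq hu.1]
    unfold adjCount
    congr 1
    ext w
    simp only [mem_bipartiteAbove, mem_trace, mem_filter, mem_univ, true_and]
    constructor
    · rintro ⟨⟨hw, -⟩, hadj⟩; exact ⟨hadj, hw⟩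
    · rintro ⟨hadj, hw⟩; exact ⟨⟨hw, hH.mem_of_adj hρ hhalf h2 hu.1 hu.2 hw hadj⟩, hadj⟩
  -- from the `y` side: every `P_x`-neighbour of `v ∈ H ∩ P_y` lies in `H` (apply the lemma to `Hᶜ`)
  have hy : ∀ v ∈ trace ρ H (ρ v₀), ((trace ρ H (ρ u₀)).bipartiteBelow (fun a b => K.Adj a b) v).card =
      adjCount K ρ v₀ (ρ u₀) := by
    intro v hv
    rw [mem_trace] at hv
    rw [← hρ.adjCount_eq hv.1]
    unfold adjCount
    congr 1
    ext w
    simp only [mem_bipartiteBelow, mem_trace, mem_filter, mem_univ, true_and]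
    constructor
    · rintro ⟨⟨hw, -⟩, hadj⟩; exact ⟨hadj.symm, hw⟩
    · rintro ⟨hadj, hw⟩
      refine ⟨⟨hw, ?_⟩, hadj.symm⟩
      by_contra hwH
      exact hH.compl.mem_of_adj hρ hhalf h2 hw (Set.mem_compl hwH) hv.1 hadj.symm hv.2
  rw [sum_congr rfl hx, sum_congr rfl hy, sum_const, sum_const, smul_eq_mul, smul_eq_mul] at hdc
  -- combine with Equation (N)
  have hN := hρ.cellCard_mul_adjCount u₀ v₀
  have hyx : 0 < adjCount K ρ v₀ (ρ u₀) := by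
    have : 0 < cellCard ρ (ρ u₀) * adjCount K ρ u₀ (ρ v₀) := Nat.mul_pos (card_pos.2 ⟨u₀, by simp⟩) h0
    rw [hN] at this
    exact Nat.pos_of_mul_pos_left this
  -- `a n = b n'` and `X n = Y n'` give `a Y n' = b X n'`
  have : (trace ρ H (ρ v₀)).card * cellCard ρ (ρ u₀) * adjCount K ρ v₀ (ρ u₀) =
      (trace ρ H (ρ u₀)).card * cellCard ρ (ρ v₀) * adjCount K ρ v₀ (ρ u₀) := by
    calc (trace ρ H (ρ v₀)).card * cellCard ρ (ρ u₀) * adjCount K ρ v₀ (ρ u₀)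
        = (trace ρ H (ρ v₀)).card * adjCount K ρ v₀ (ρ u₀) * cellCard ρ (ρ u₀) := by ring
      _ = (trace ρ H (ρ u₀)).card * adjCount K ρ u₀ (ρ v₀) * cellCard ρ (ρ u₀) := by rw [hdc]
      _ = (trace ρ H (ρ u₀)).card * (cellCard ρ (ρ u₀) * adjCount K ρ u₀ (ρ v₀)) := by ring
      _ = (trace ρ H (ρ u₀)).card * (cellCard ρ (ρ v₀) * adjCount K ρ v₀ (ρ u₀)) := by rw [hN]
      _ = (trace ρ H (ρ u₀)).card * cellCard ρ (ρ v₀) * adjCount K ρ v₀ (ρ u₀) := by ring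
  exact Nat.eq_of_mul_eq_mul_right hyx this

/-- **Traces are transported across a forced block**: if `Q` and `H` have equal traces on `P_x`,
they have equal traces on `P_y`; if complementary on `P_x`, then complementary on `P_y`.
[cite: Laubner2011, proof of Lemma 3.3.7] -/
theorem trace_transport_of_forced (hρ : IsEquitable K ρ)
    (hhalf : ∀ (u : V) (d : κ), 2 * adjCount K ρ u d ≤ cellCard ρ d) (hH : IsSection K ρ H)
    {Q : Set V} [DecidablePred (· ∈ Q)] (hQ : IsSection K ρ Q)
    {u₀ : V} {y : κ} (h0 : 0 < adjCount K ρ u₀ y) (h2 : 2 * adjCount K ρ u₀ y < cellCard ρ y)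
    (hx : trace ρ Q (ρ u₀) = trace ρ H (ρ u₀)) : trace ρ Q y = trace ρ H y := by
  ext v
  simp only [mem_trace]
  refine and_congr_right fun hv => ?_
  rw [hQ.mem_iff_exists_adj hρ hhalf h0 h2 hv, hH.mem_iff_exists_adj hρ hhalf h0 h2 hv]
  constructor
  · rintro ⟨u, huQ, hu, hadj⟩
    have : u ∈ trace ρ Q (ρ u₀) := by simp [hu, huQ]
    rw [hx, mem_trace] at this
    exact ⟨u, this.2, hu, hadj⟩
  · rintro ⟨u, huH, hu, hadj⟩
    have : u ∈ trace ρ H (ρ u₀) := by simp [hu, huH]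
    rw [← hx, mem_trace] at this
    exact ⟨u, this.2, hu, hadj⟩

end Forced

/-! ## Lemma 3.3.7 -/

section Halved

variable {H : Set V} [DecidablePred (· ∈ H)]

/-- One propagation step for empty traces along an edge (forced or exact-half block). [cite: Laubner2011, proof of Lemma 3.3.7] -/
theorem trace_empty_step (hρ : IsEquitable K ρ)
    (hhalf : ∀ (u : V) (d : κ), 2 * adjCount K ρ u d ≤ cellCard ρ d) (hH : IsSection K ρ H)
    {u v : V} (hadj : K.Adj u v) (hu : ∀ w, ρ w = ρ u → w ∉ H) : ∀ w, ρ w = ρ v → w ∉ H := by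
  intro w hw
  have h1 : 0 < adjCount K ρ u (ρ v) := card_pos.2 ⟨v, by simp [hadj]⟩
  rcases (hhalf u (ρ v)).lt_or_eq with hlt | heq
  · -- forced block: proportional traces
    have hmul := card_trace_mul_of_forced hρ hhalf hH h1 hlt
    have h0 : (trace ρ H (ρ u)).card = 0 := card_eq_zero.2 (eq_empty_of_forall_notMem fun z hz => by
      rw [mem_trace] at hz
      exact hu z hz.1 hz.2)
    rw [h0, zero_mul] at hmul
    have hX : 0 < cellCard ρ (ρ u) := card_pos.2 ⟨u, by simp⟩
    have hzero : (trace ρ H (ρ v)).card = 0 := by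
      rcases Nat.mul_eq_zero.1 hmul with h | h
      · exact h
      · omega
    intro hwH
    have : w ∈ trace ρ H (ρ v) := by simp [hw, hwH]
    rw [card_eq_zero.1 hzero] at this
    exact notMem_empty _ this
  · exact trace_empty_of_halfBlock hρ hhalf hH heq hu hw

/-- **Lemma 3.3.7 (1): in a preconnected, equitable, half-bounded graph with an exact-half
block, a non-trivial section halves every colour class.** [cite: Laubner2011, Lemma 3.3.7] -/
theorem IsSection.two_mul_card_trace (hK : K.Preconnected) (hρ : IsEquitable K ρ)
    (hhalf : ∀ (u : V) (d : κ), 2 * adjCount K ρ u d ≤ cellCard ρ d) (hH : IsSection K ρ H)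
    (hne : H.Nonempty) (hnc : Hᶜ.Nonempty) {a₀ : V} {b₀ : V}
    (hblk : 2 * adjCount K ρ a₀ (ρ b₀) = cellCard ρ (ρ b₀)) (c : V) :
    2 * (trace ρ H (ρ c)).card = cellCard ρ (ρ c) := by
  haveI : DecidablePred (· ∈ Hᶜ) := fun x => show Decidable (x ∉ H) from inferInstance
  -- Step 1: no class has an empty trace, none a full trace (else `H = ∅` resp. `H = univ`)
  have noEmpty : ∀ u : V, ∃ w, ρ w = ρ u ∧ w ∈ H := by
    by_contra hcon
    obtain ⟨u, hu⟩ := not_forall.1 hcon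
    have hu' : ∀ w, ρ w = ρ u → w ∉ H := fun w hw hwH => hu ⟨w, hw, hwH⟩
    have hall := eq_univ_of_adjClosed hK (C := {v | ∀ w, ρ w = ρ v → w ∉ H})
      (fun a b ha hab => trace_empty_step hρ hhalf hH hab ha) (u := u) hu'
    obtain ⟨h, hh⟩ := hne
    have : h ∈ ({v | ∀ w, ρ w = ρ v → w ∉ H} : Set V) := by
      rw [hall]
      exact Set.mem_univ _
    exact this h rfl hh
  have noFull : ∀ u : V, ∃ w, ρ w = ρ u ∧ w ∉ H := by
    by_contra hcon
    obtain ⟨u, hu⟩ := not_forall.1 hcon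
    have hu' : ∀ w, ρ w = ρ u → w ∉ Hᶜ := fun w hw hwH => hu ⟨w, hw, hwH⟩
    have hall := eq_univ_of_adjClosed hK (C := {v | ∀ w, ρ w = ρ v → w ∉ Hᶜ})
      (fun a b ha hab => trace_empty_step hρ hhalf hH.compl hab ha) (u := u) hu'
    obtain ⟨h, hh⟩ := hnc
    have : h ∈ ({v | ∀ w, ρ w = ρ v → w ∉ Hᶜ} : Set V) := by
      rw [hall]
      exact Set.mem_univ _
    exact this h rfl hh
  -- Step 2: the seed class `P_{b₀}` is halved, and halving propagates along edges
  have hseed : 2 * (trace ρ H (ρ b₀)).card = cellCard ρ (ρ b₀) := by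
    obtain ⟨u₁, hu₁, hu₁H⟩ := noEmpty a₀
    obtain ⟨u₂, hu₂, hu₂H⟩ := noFull a₀
    exact two_mul_card_trace_of_halfBlock hρ hH hblk hu₁ hu₁H hu₂ hu₂H
  have hprop : ∀ {u v : V}, K.Adj u v → 2 * (trace ρ H (ρ u)).card = cellCard ρ (ρ u) →
      2 * (trace ρ H (ρ v)).card = cellCard ρ (ρ v) := by
    intro u v hadj hu
    have h1 : 0 < adjCount K ρ u (ρ v) := card_pos.2 ⟨v, by simp [hadj]⟩
    rcases (hhalf u (ρ v)).lt_or_eq with hlt | heq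
    · have hmul := card_trace_mul_of_forced hρ hhalf hH h1 hlt
      have hX : 0 < cellCard ρ (ρ u) := card_pos.2 ⟨u, by simp⟩
      have : 2 * (trace ρ H (ρ v)).card * cellCard ρ (ρ u) = cellCard ρ (ρ v) * cellCard ρ (ρ u) := by
        rw [Nat.mul_assoc, hmul, ← Nat.mul_assoc, hu, Nat.mul_comm]
      exact Nat.eq_of_mul_eq_mul_right hX this
    · obtain ⟨u₁, hu₁, hu₁H⟩ := noEmpty u
      obtain ⟨u₂, hu₂, hu₂H⟩ := noFull u
      exact two_mul_card_trace_of_halfBlock hρ hH heq hu₁ hu₁H hu₂ hu₂H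
  have hall := eq_univ_of_adjClosed hK (C := {v | 2 * (trace ρ H (ρ v)).card = cellCard ρ (ρ v)})
    (fun a b ha hab => hprop hab ha) (u := b₀) hseed
  have : c ∈ ({v | 2 * (trace ρ H (ρ v)).card = cellCard ρ (ρ v)} : Set V) := by
    rw [hall]
    exact Set.mem_univ _
  exact this

/-- **Lemma 3.3.7 (2): two non-trivial sections have equal or complementary traces on every
class.** [cite: Laubner2011, Lemma 3.3.7] -/
theorem IsSection.trace_eq_or_compl (hK : K.Preconnected) (hρ : IsEquitable K ρ)
    (hhalf : ∀ (u : V) (d : κ), 2 * adjCount K ρ u d ≤ cellCard ρ d) (hH : IsSection K ρ H)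
    (hne : H.Nonempty) (hnc : Hᶜ.Nonempty) {Q : Set V} [DecidablePred (· ∈ Q)] (hQ : IsSection K ρ Q)
    (hQne : Q.Nonempty) (hQnc : Qᶜ.Nonempty) {a₀ b₀ : V}
    (hblk : 2 * adjCount K ρ a₀ (ρ b₀) = cellCard ρ (ρ b₀)) (c : V) :
    trace ρ Q (ρ c) = trace ρ H (ρ c) ∨ trace ρ Q (ρ c) = (univ.filter fun w => ρ w = ρ c) \ trace ρ H (ρ c) := by
  haveI : DecidablePred (· ∈ Hᶜ) := fun x => show Decidable (x ∉ H) from inferInstance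
  have hcompl : ∀ d : κ, (univ.filter fun w => ρ w = d) \ trace ρ H d = trace ρ Hᶜ d := fun d => by
    ext w
    simp only [mem_sdiff, mem_filter, mem_univ, true_and, mem_trace, Set.mem_compl_iff]
    tauto
  simp only [hcompl]
  -- at an exact-half block both traces are `N(u) ∩ P_y` or its complement: they agree or are complementary
  have athalf : ∀ {u v : V}, 2 * adjCount K ρ u (ρ v) = cellCard ρ (ρ v) →
      trace ρ Q (ρ v) = trace ρ H (ρ v) ∨ trace ρ Q (ρ v) = trace ρ Hᶜ (ρ v) := by
    intro u v hb
    have hHv := hH.two_mul_card_trace hK hρ hhalf hne hnc hb v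
    have hQv := hQ.two_mul_card_trace hK hρ hhalf hQne hQnc hb v
    have h1 := trace_eq_or_eq_of_halfBlock hρ hH hb hHv (u := u) rfl
    have h2 := trace_eq_or_eq_of_halfBlock hρ hQ hb hQv (u := u) rfl
    rw [← hcompl]
    have hHc : trace ρ Hᶜ (ρ v) = (univ.filter fun w => ρ w = ρ v) \ trace ρ H (ρ v) := (hcompl _).symm
    have htr_sub : trace ρ H (ρ v) ⊆ univ.filter fun w => ρ w = ρ v := fun w hw => by
      simp only [mem_trace, mem_filter, mem_univ, true_and] at hw ⊢; exact hw.1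
    have hN_sub : univ.filter (fun w => K.Adj u w ∧ ρ w = ρ v) ⊆ univ.filter fun w => ρ w = ρ v := fun w hw => by
      simp only [mem_filter, mem_univ, true_and] at hw ⊢; exact hw.2
    rcases h1 with h1 | h1 <;> rcases h2 with h2 | h2
    · left; rw [h1, h2]
    · right; rw [h2, h1]
    · right; rw [h2, h1, sdiff_sdiff_right_self, inf_eq_inter, inter_eq_right.2 hN_sub]
    · left; rw [h1, h2]
  -- propagation along edges
  have hprop : ∀ {u v : V}, K.Adj u v →
      (trace ρ Q (ρ u) = trace ρ H (ρ u) ∨ trace ρ Q (ρ u) = trace ρ Hᶜ (ρ u)) →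
      (trace ρ Q (ρ v) = trace ρ H (ρ v) ∨ trace ρ Q (ρ v) = trace ρ Hᶜ (ρ v)) := by
    intro u v hadj hu
    have h1 : 0 < adjCount K ρ u (ρ v) := card_pos.2 ⟨v, by simp [hadj]⟩
    rcases (hhalf u (ρ v)).lt_or_eq with hlt | heq
    · rcases hu with hu | hu
      · exact Or.inl (trace_transport_of_forced hρ hhalf hH hQ h1 hlt hu)
      · exact Or.inr (trace_transport_of_forced hρ hhalf hH.compl hQ h1 hlt hu)
    · exact athalf heq
  have hall := eq_univ_of_adjClosed hK
    (C := {v | trace ρ Q (ρ v) = trace ρ H (ρ v) ∨ trace ρ Q (ρ v) = trace ρ Hᶜ (ρ v)})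
    (fun a b ha hab => hprop hab ha) (u := b₀) (athalf hblk)
  have : c ∈ ({v | trace ρ Q (ρ v) = trace ρ H (ρ v) ∨ trace ρ Q (ρ v) = trace ρ Hᶜ (ρ v)} : Set V) := by
    rw [hall]; exact Set.mem_univ _
  exact this

end Halved

end Literature.Combinatorics.SimpleGraph
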